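import Summits.CriticalPhenomena.PercolationContinuityZ3.Theorems.Transplant.FKConnectivityAllQApexHubForms
import Summits.CriticalPhenomena.PercolationContinuityZ3.Theorems.Transplant.FKConnectivityAllQApexHubTwoAlg
import HarnessLib

/-!
# Connectivity correlation inequalities for `φ_{w,q}`, every `q > 0` — the HUB INEQUALITY AT AN APEX, file 4:
# TWO apex terminals — Ayyer–Linusson–Ravichandran's (13)/(14) at `(u; x; y)` and `(x; u; y)` for apexes `x, y` over `(u, v)`
# in an ARBITRARY weighted graph, every `0 < q ≤ 1`

Support file (`--supports stmt-CriticalPhenomena-4575`), census seat `prim-bschramm-census` (gen 22) of the post-continuity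
programme; builds on p205010 (kernel theorem, internal audit signed; external expert review pending).  No definitions, no named
facts, no sorries; standard axioms.  Continues `…ApexHubCyl.lean` (cylinders, table lemma) and `…ApexHubForms.lean` (level-one
dictionary).

SETTING.  `u ≠ v`; `x, y` two distinct APEXES over `(u, v)` (every live pair at `x` is `ux` or `xv`, at `y` is `uy` or `yv`); the rest
of the weighted graph is arbitrary.  Peel `x` by the table lemma (its auxiliary events are `u ↔ v`, `u ↔ y`, `v ↔ y` avoiding the pairs
of `x`), then read the masses under `w[ux, xv ↦ 0]` from the level-one dictionary of the apex `y`; everything is a polynomial in the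
leaf-type weights of `x` and `y`, `r = q⁻¹`, and the base masses `A₀ = S°°(u ↔ v avoiding both apexes)`, `B₀ = S°°(complement)`.
* **`hubUnder_apex_two_leaf`** (`(o,a,b) = (u,x,y)`, hub at the apex `x`): `φ(u ↔ x)·φ(y ↔ x) ≤ φ(u ↔ x ↔ y)`, all `0 < q ≤ 1`;
* **`hubUnder_apex_two_hub`** (`(o,a,b) = (x,u,y)`, hub at `u`, both legs apexes): `φ(x ↔ u)·φ(y ↔ u) ≤ φ(x ↔ u ↔ y)`, all `0 < q ≤ 1`.
The defects are polynomials with NONNEGATIVE coefficients in the leaf-type weights, `s = r − 1`, `A₀`, `B₀` after reduction modulo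
`U·V' = W·N·r` per leaf (27+51+49 and 0+24+27 terms; census seat gen 22, exact computer algebra `code/apexhub_uvw.py`,
`code/cert_uvw.py`, brute-force cross-check `code/check_forms2.py`); kernel: `ring` + `positivity`.  On the double cone `K_{1,1,2}`
these two triples were already covered by Wagner's theorem (`edgeNegCorr_K4` + `hubUnder_of_edgeNegCorr_on`); the point here is the
ARBITRARY rest of the graph, and the method, which file 5 (`…ApexHubThree.lean`) runs for three apex terminals — the one triple
type of a double cone not reachable by the series–parallel theorems.
[cite: AyyerLinussonRavichandran2025, §7 eq. (13)–(15), Conj. 7.1 (p. 22)] [cite: Grimmett2006, Thm. (3.1)(a) (p. 37); §1.4 eq. (1.20) (p. 15); §3.9 (p. 63)]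
[cite: Wagner2006, Ex. 5.1, §5.3]
-/

noncomputable section

namespace Summit.CriticalPhenomena.PercolationContinuityZ3.Theorems

namespace FK

open MeasureTheory Set Literature.Probability.LatticeModels Literature.Probability.Percolation
open Literature.Probability.Percolation.DecisionTree (ind ind_of_mem ind_of_not_mem ind_nonneg)
open Literature.Probability.Percolation.TwoAvoidanceSets (ind_mul_ind)
open scoped Classical symmDiff

variable {V : Type*} [Fintype V]

/-! ### The hub inequality at `(u; x; y)`: hub at the apex `x`, legs `u` and the apex `y` -/

/-- **The hub inequality at `(u; x; y)` for two apexes `x, y` over `(u, v)` — every `0 < q ≤ 1`, any surrounding weighted graph**: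
`φ_{w,q}(u ↔ x)·φ_{w,q}(y ↔ x) ≤ φ_{w,q}(u ↔ x ↔ y)` (Ayyer–Linusson–Ravichandran's (13)/(14) with the hub at an apex and one leg
at another apex; on `K_{1,1,2}` this is Wagner + `hubUnder_of_edgeNegCorr_on`, here the rest of the graph is arbitrary).
[cite: AyyerLinussonRavichandran2025, §7 eq. (13)–(14) (p. 22)] [cite: Grimmett2006, §3.9 (p. 63)] -/
theorem hubUnder_apex_two_leaf (w : Sym2 V → unitInterval) {q : ℝ} (hq : 0 < q) (hq1 : q ≤ 1) {u v x y : V}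
    (hxu : x ≠ u) (hxv : x ≠ v) (hyu : y ≠ u) (hyv : y ≠ v) (hxy : x ≠ y) (huv : u ≠ v)
    (hwx : ∀ e : Sym2 V, x ∈ e → ((w e : unitInterval) : ℝ) ≠ 0 → u ∈ e ∨ v ∈ e)
    (hwy : ∀ e : Sym2 V, y ∈ e → ((w e : unitInterval) : ℝ) ≠ 0 → u ∈ e ∨ v ∈ e) :
    HubUnder (rcMeasureW w q ∅) u x y := by
  have hq0 : q ≠ 0 := hq.ne'
  -- auxiliary events read off `ω ∖ {ux, xv}`
  have hKa := diffApex_insens u v x (openConn u v) (Or.inl rfl)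
  have hKb := diffApex_insens u v x (openConn u v) (Or.inr rfl)
  have hYUa := diffApex_insens u v x (openConn u y) (Or.inl rfl)
  have hYUb := diffApex_insens u v x (openConn u y) (Or.inr rfl)
  have hYVa := diffApex_insens u v x (openConn v y) (Or.inl rfl)
  have hYVb := diffApex_insens u v x (openConn v y) (Or.inr rfl)
  have hapex : ∀ ω, rcWeightW w q ∅ ω ≠ 0 → ∀ e ∈ ω, x ∈ e → e = s(u, x) ∨ e = s(x, v) :=
    fun ω hω => apex_of_rcWeightW_ne_zero w q hxu hxv hwx hω
  have hadj : ∀ ω : BondConfig V, s(u, x) ∈ ω → ω ∈ (openConn u x : Set (BondConfig V)) := fun ω ha =>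
    mem_openConn_of_mem hxu.symm ha
  -- `y ↔ x` through the apex `x`
  have hyx : ∀ ω : BondConfig V, rcWeightW w q ∅ ω ≠ 0 → (ω ∈ (openConn y x : Set (BondConfig V)) ↔
      (s(u, x) ∈ ω ∧ ω ∈ {ω : BondConfig V | ω \ {s(u, x), s(x, v)} ∈ (openConn u y : Set (BondConfig V))}) ∨ (s(x, v) ∈ ω ∧ ω ∈ {ω : BondConfig V | ω \ {s(u, x), s(x, v)} ∈ (openConn v y : Set (BondConfig V))})) := fun ω hω => by
    rw [mem_openConn_iff', Set.mem_setOf_eq, Set.mem_setOf_eq, mem_openConn_iff', mem_openConn_iff']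
    rw [show (openGraph ω).Reachable y x ↔ (openGraph ω).Reachable x y from ⟨SimpleGraph.Reachable.symm, SimpleGraph.Reachable.symm⟩]
    exact reachable_apex_iff hxv hxy (hapex ω hω)
  have hux : ∀ ω : BondConfig V, rcWeightW w q ∅ ω ≠ 0 → s(u, x) ∉ ω →
      (ω ∈ (openConn u x : Set (BondConfig V)) ↔ s(x, v) ∈ ω ∧ ω ∈ {ω : BondConfig V | ω \ {s(u, x), s(x, v)} ∈ (openConn u v : Set (BondConfig V))}) := fun ω hω ha => by
    rw [mem_openConn_iff', reachable_ux_apex_iff hxu hxv (hapex ω hω), Set.mem_setOf_eq, mem_openConn_iff']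
    exact ⟨fun h => h.elim (fun h' => absurd h' ha) id, Or.inr⟩
  -- level one: the tables of the apex `x`
  have hA := apex_mass_table w hq0 hxu hxv huv hwx (openConn u x) Set.univ Set.univ {ω : BondConfig V | ω \ {s(u, x), s(x, v)} ∈ (openConn u v : Set (BondConfig V))} ∅
    (fun ω _ ha _ => iff_of_true (hadj ω ha) (Set.mem_univ _))
    (fun ω _ _ ha => iff_of_true (hadj ω ha) (Set.mem_univ _))
    (fun ω hω ha hb => by rw [hux ω hω ha]; exact ⟨fun h => h.2, fun h => ⟨hb, h⟩⟩)
    (fun ω hω ha hb => by rw [hux ω hω ha]; exact ⟨fun h => absurd h.1 hb, fun h => absurd h (Set.notMem_empty ω)⟩)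
    (univ_insens _) (univ_insens _) (univ_insens _) hKb
  have hB := apex_mass_table w hq0 hxu hxv huv hwx (openConn y x) ({ω : BondConfig V | ω \ {s(u, x), s(x, v)} ∈ (openConn u y : Set (BondConfig V))} ∪ {ω : BondConfig V | ω \ {s(u, x), s(x, v)} ∈ (openConn v y : Set (BondConfig V))}) {ω : BondConfig V | ω \ {s(u, x), s(x, v)} ∈ (openConn u y : Set (BondConfig V))} {ω : BondConfig V | ω \ {s(u, x), s(x, v)} ∈ (openConn v y : Set (BondConfig V))} ∅
    (fun ω hω ha hb => by
      rw [hyx ω hω, Set.mem_union]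
      exact ⟨fun h => h.elim (fun h' => Or.inl h'.2) fun h' => Or.inr h'.2, fun h => h.elim (fun h' => Or.inl ⟨ha, h'⟩) fun h' => Or.inr ⟨hb, h'⟩⟩)
    (fun ω hω hb ha => by
      rw [hyx ω hω]
      exact ⟨fun h => h.elim (fun h' => h'.2) fun h' => absurd h'.1 hb, fun h => Or.inl ⟨ha, h⟩⟩)
    (fun ω hω ha hb => by
      rw [hyx ω hω]
      exact ⟨fun h => h.elim (fun h' => absurd h'.1 ha) fun h' => h'.2, fun h => Or.inr ⟨hb, h⟩⟩)
    (fun ω hω ha hb => by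
      rw [hyx ω hω]
      exact ⟨fun h => h.elim (fun h' => absurd h'.1 ha) fun h' => absurd h'.1 hb, fun h => absurd h (Set.notMem_empty ω)⟩)
    (union_insens hYUa hYVa) (union_insens hYUb hYVb) hYUa hYVb
  have hAB := apex_mass_table w hq0 hxu hxv huv hwx ((openConn u x : Set (BondConfig V)) ∩ openConn y x)
    ({ω : BondConfig V | ω \ {s(u, x), s(x, v)} ∈ (openConn u y : Set (BondConfig V))} ∪ {ω : BondConfig V | ω \ {s(u, x), s(x, v)} ∈ (openConn v y : Set (BondConfig V))}) {ω : BondConfig V | ω \ {s(u, x), s(x, v)} ∈ (openConn u y : Set (BondConfig V))} ({ω : BondConfig V | ω \ {s(u, x), s(x, v)} ∈ (openConn u v : Set (BondConfig V))} ∩ {ω : BondConfig V | ω \ {s(u, x), s(x, v)} ∈ (openConn v y : Set (BondConfig V))}) ∅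
    (fun ω hω ha hb => by
      rw [Set.mem_inter_iff, hyx ω hω, Set.mem_union]
      constructor
      · rintro ⟨-, h⟩; exact h.elim (fun h' => Or.inl h'.2) fun h' => Or.inr h'.2
      · intro h; exact ⟨hadj ω ha, h.elim (fun h' => Or.inl ⟨ha, h'⟩) fun h' => Or.inr ⟨hb, h'⟩⟩)
    (fun ω hω hb ha => by
      rw [Set.mem_inter_iff, hyx ω hω]
      constructor
      · rintro ⟨-, h⟩; exact h.elim (fun h' => h'.2) fun h' => absurd h'.1 hb
      · intro h; exact ⟨hadj ω ha, Or.inl ⟨ha, h⟩⟩)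
    (fun ω hω ha hb => by
      rw [Set.mem_inter_iff, hyx ω hω, hux ω hω ha, Set.mem_inter_iff]
      constructor
      · rintro ⟨h1, h2⟩; exact ⟨h1.2, h2.elim (fun h' => absurd h'.1 ha) fun h' => h'.2⟩
      · rintro ⟨h1, h2⟩; exact ⟨⟨hb, h1⟩, Or.inr ⟨hb, h2⟩⟩)
    (fun ω hω ha hb => by
      rw [Set.mem_inter_iff, hux ω hω ha]
      exact ⟨fun h => absurd h.1.1 hb, fun h => absurd h (Set.notMem_empty ω)⟩)
    (union_insens hYUa hYVa) (union_insens hYUb hYVb) hYUa (inter_insens hKb hYVb)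
  have hZ := apex_mass_table w hq0 hxu hxv huv hwx Set.univ Set.univ Set.univ Set.univ Set.univ
    (fun _ _ _ _ => Iff.rfl) (fun _ _ _ _ => Iff.rfl) (fun _ _ _ _ => Iff.rfl) (fun _ _ _ _ => Iff.rfl)
    (univ_insens _) (univ_insens _) (univ_insens _) (univ_insens _)
  -- level two: under `w[ux, xv ↦ 0]` the auxiliary events are plain connection events, and `y` is still an apex
  have hda := apexDead_fst w hxu huv
  have hdb := apexDead_snd w u v x
  have cK : ∑ ω : BondConfig V, rcWeightW (Function.update (Function.update w s(u, x) 0) s(x, v) 0) q ∅ ω * ind {ω : BondConfig V | ω \ {s(u, x), s(x, v)} ∈ (openConn u v : Set (BondConfig V))} ω = ∑ ω : BondConfig V, rcWeightW (Function.update (Function.update w s(u, x) 0) s(x, v) 0) q ∅ ω * ind (openConn u v : Set (BondConfig V)) ω := by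
    rw [← Set.univ_inter {ω : BondConfig V | ω \ {s(u, x), s(x, v)} ∈ (openConn u v : Set (BondConfig V))}, sum_inter_preimageDiff_dead _ q hda hdb, Set.univ_inter]
  have cKc : ∑ ω : BondConfig V, rcWeightW (Function.update (Function.update w s(u, x) 0) s(x, v) 0) q ∅ ω * ind (Set.univ ∩ {ω : BondConfig V | ω \ {s(u, x), s(x, v)} ∈ (openConn u v : Set (BondConfig V))}ᶜ) ω =
      ∑ ω : BondConfig V, rcWeightW (Function.update (Function.update w s(u, x) 0) s(x, v) 0) q ∅ ω * ind (openConn u v : Set (BondConfig V))ᶜ ω := by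
    refine sum_rcWeightW_ind_congr_ae _ q fun ω hω => ?_
    rw [Set.mem_inter_iff, Set.mem_compl_iff, Set.mem_setOf_eq, diff_apex_eq_self_ae _ q hda hdb hω, Set.mem_compl_iff]
    exact ⟨fun h => h.2, fun h => ⟨Set.mem_univ _, h⟩⟩
  have cYU : ∑ ω : BondConfig V, rcWeightW (Function.update (Function.update w s(u, x) 0) s(x, v) 0) q ∅ ω * ind {ω : BondConfig V | ω \ {s(u, x), s(x, v)} ∈ (openConn u y : Set (BondConfig V))} ω = ∑ ω : BondConfig V, rcWeightW (Function.update (Function.update w s(u, x) 0) s(x, v) 0) q ∅ ω * ind (openConn u y : Set (BondConfig V)) ω := by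
    rw [← Set.univ_inter {ω : BondConfig V | ω \ {s(u, x), s(x, v)} ∈ (openConn u y : Set (BondConfig V))}, sum_inter_preimageDiff_dead _ q hda hdb, Set.univ_inter]
  have cYV : ∑ ω : BondConfig V, rcWeightW (Function.update (Function.update w s(u, x) 0) s(x, v) 0) q ∅ ω * ind {ω : BondConfig V | ω \ {s(u, x), s(x, v)} ∈ (openConn v y : Set (BondConfig V))} ω = ∑ ω : BondConfig V, rcWeightW (Function.update (Function.update w s(u, x) 0) s(x, v) 0) q ∅ ω * ind (openConn v y : Set (BondConfig V)) ω := by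
    rw [← Set.univ_inter {ω : BondConfig V | ω \ {s(u, x), s(x, v)} ∈ (openConn v y : Set (BondConfig V))}, sum_inter_preimageDiff_dead _ q hda hdb, Set.univ_inter]
  have cATT : ∑ ω : BondConfig V, rcWeightW (Function.update (Function.update w s(u, x) 0) s(x, v) 0) q ∅ ω * ind ({ω : BondConfig V | ω \ {s(u, x), s(x, v)} ∈ (openConn u y : Set (BondConfig V))} ∪ {ω : BondConfig V | ω \ {s(u, x), s(x, v)} ∈ (openConn v y : Set (BondConfig V))}) ω =
      ∑ ω : BondConfig V, rcWeightW (Function.update (Function.update w s(u, x) 0) s(x, v) 0) q ∅ ω * ind ((openConn u y : Set (BondConfig V)) ∪ openConn v y) ω := by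
    refine sum_rcWeightW_ind_congr_ae _ q fun ω hω => ?_
    rw [Set.mem_union, Set.mem_union, Set.mem_setOf_eq, Set.mem_setOf_eq, diff_apex_eq_self_ae _ q hda hdb hω]
  have cSEP : ∑ ω : BondConfig V, rcWeightW (Function.update (Function.update w s(u, x) 0) s(x, v) 0) q ∅ ω * ind (({ω : BondConfig V | ω \ {s(u, x), s(x, v)} ∈ (openConn u y : Set (BondConfig V))} ∪ {ω : BondConfig V | ω \ {s(u, x), s(x, v)} ∈ (openConn v y : Set (BondConfig V))}) ∩ {ω : BondConfig V | ω \ {s(u, x), s(x, v)} ∈ (openConn u v : Set (BondConfig V))}ᶜ) ω =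
      ∑ ω : BondConfig V, rcWeightW (Function.update (Function.update w s(u, x) 0) s(x, v) 0) q ∅ ω * ind (((openConn u y : Set (BondConfig V)) ∪ openConn v y) ∩ (openConn u v)ᶜ) ω := by
    refine sum_rcWeightW_ind_congr_ae _ q fun ω hω => ?_
    simp only [Set.mem_inter_iff, Set.mem_union, Set.mem_compl_iff, Set.mem_setOf_eq, diff_apex_eq_self_ae _ q hda hdb hω]
  have cKYV : ∑ ω : BondConfig V, rcWeightW (Function.update (Function.update w s(u, x) 0) s(x, v) 0) q ∅ ω * ind ({ω : BondConfig V | ω \ {s(u, x), s(x, v)} ∈ (openConn u v : Set (BondConfig V))} ∩ {ω : BondConfig V | ω \ {s(u, x), s(x, v)} ∈ (openConn v y : Set (BondConfig V))}) ω =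
      ∑ ω : BondConfig V, rcWeightW (Function.update (Function.update w s(u, x) 0) s(x, v) 0) q ∅ ω * ind ((openConn u v : Set (BondConfig V)) ∩ openConn v y) ω := by
    refine sum_rcWeightW_ind_congr_ae _ q fun ω hω => ?_
    simp only [Set.mem_inter_iff, Set.mem_setOf_eq, diff_apex_eq_self_ae _ q hda hdb hω]
  have cE : ∑ ω : BondConfig V, rcWeightW (Function.update (Function.update w s(u, x) 0) s(x, v) 0) q ∅ ω * ind (∅ : Set (BondConfig V)) ω = 0 := sum_rcWeightW_ind_empty _ q
  rw [cKc, cK] at hA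
  rw [cATT, cSEP, cYU, cYV] at hB
  rw [cATT, cSEP, cYU, cKYV] at hAB
  rw [cKc] at hZ
  -- the level-one dictionary of the apex `y` under `w[ux, xv ↦ 0]`
  have hwy' : ∀ e : Sym2 V, y ∈ e → (((Function.update (Function.update w s(u, x) 0) s(x, v) 0) e : unitInterval) : ℝ) ≠ 0 → u ∈ e ∨ v ∈ e :=
    apex_hyp_update (apex_hyp_update hwy s(u, x) (fun _ => Or.inl (Sym2.mem_mk_left u x)) 0) s(x, v)
      (fun _ => Or.inr (Sym2.mem_mk_right x v)) 0
  have hZx := apexForm_univ (Function.update (Function.update w s(u, x) 0) s(x, v) 0) hq0 hyu hyv huv hwy'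
  have hUV := apexForm_uv (Function.update (Function.update w s(u, x) 0) s(x, v) 0) hq0 hyu hyv huv hwy'
  have hUY := apexForm_uy (Function.update (Function.update w s(u, x) 0) s(x, v) 0) hq0 hyu hyv huv hwy'
  have hVY := apexForm_vy (Function.update (Function.update w s(u, x) 0) s(x, v) 0) hq0 hyu hyv huv hwy'
  have hATT := apexForm_att (Function.update (Function.update w s(u, x) 0) s(x, v) 0) hq0 hyu hyv huv hwy'
  have hSEP := apexForm_att_sep (Function.update (Function.update w s(u, x) 0) s(x, v) 0) hq0 hyu hyv huv hwy'
  have hUVY := apexForm_uv_vy (Function.update (Function.update w s(u, x) 0) s(x, v) 0) hq0 hyu hyv huv hwy'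
  have hsplit := sum_rcWeightW_ind_univ_eq_add (Function.update (Function.update (Function.update (Function.update w s(u, x) 0) s(x, v) 0) s(u, y) 0) s(y, v) 0) q
    {ω : BondConfig V | ω \ {s(u, y), s(y, v)} ∈ (openConn u v : Set (BondConfig V))}
  rw [hsplit] at hZx hUV hUY hVY hATT hUVY
  have hKc : ∑ ω : BondConfig V, rcWeightW (Function.update (Function.update w s(u, x) 0) s(x, v) 0) q ∅ ω * ind (openConn u v : Set (BondConfig V))ᶜ ω =
      ∑ ω : BondConfig V, rcWeightW (Function.update (Function.update w s(u, x) 0) s(x, v) 0) q ∅ ω * ind (Set.univ : Set (BondConfig V)) ω - ∑ ω : BondConfig V, rcWeightW (Function.update (Function.update w s(u, x) 0) s(x, v) 0) q ∅ ω * ind (openConn u v : Set (BondConfig V)) ω := by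
    rw [sum_rcWeightW_ind_compl, sum_rcWeightW_ind_univ]
  -- signs
  have hA0 := sum_rcWeightW_ind_nonneg (Function.update (Function.update (Function.update (Function.update w s(u, x) 0) s(x, v) 0) s(u, y) 0) s(y, v) 0) hq.le
    {ω : BondConfig V | ω \ {s(u, y), s(y, v)} ∈ (openConn u v : Set (BondConfig V))}
  have hB0 := sum_rcWeightW_ind_nonneg (Function.update (Function.update (Function.update (Function.update w s(u, x) 0) s(x, v) 0) s(u, y) 0) s(y, v) 0) hq.le
    {ω : BondConfig V | ω \ {s(u, y), s(y, v)} ∈ (openConn u v : Set (BondConfig V))}ᶜ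
  have ha₁ : 0 ≤ ((w s(u, x) : unitInterval) : ℝ) := (w s(u, x)).2.1
  have ha₁' : 0 ≤ 1 - ((w s(u, x) : unitInterval) : ℝ) := sub_nonneg.2 (w s(u, x)).2.2
  have hb₁ : 0 ≤ ((w s(x, v) : unitInterval) : ℝ) := (w s(x, v)).2.1
  have hb₁' : 0 ≤ 1 - ((w s(x, v) : unitInterval) : ℝ) := sub_nonneg.2 (w s(x, v)).2.2
  have ha₂ : 0 ≤ (((Function.update (Function.update w s(u, x) 0) s(x, v) 0) s(u, y) : unitInterval) : ℝ) := ((Function.update (Function.update w s(u, x) 0) s(x, v) 0) s(u, y)).2.1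
  have ha₂' : 0 ≤ 1 - (((Function.update (Function.update w s(u, x) 0) s(x, v) 0) s(u, y) : unitInterval) : ℝ) := sub_nonneg.2 ((Function.update (Function.update w s(u, x) 0) s(x, v) 0) s(u, y)).2.2
  have hb₂ : 0 ≤ (((Function.update (Function.update w s(u, x) 0) s(x, v) 0) s(y, v) : unitInterval) : ℝ) := ((Function.update (Function.update w s(u, x) 0) s(x, v) 0) s(y, v)).2.1
  have hb₂' : 0 ≤ 1 - (((Function.update (Function.update w s(u, x) 0) s(x, v) 0) s(y, v) : unitInterval) : ℝ) := sub_nonneg.2 ((Function.update (Function.update w s(u, x) 0) s(x, v) 0) s(y, v)).2.2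
  have hr : q⁻¹ = 1 + (q⁻¹ - 1) := by ring
  have hs : 0 ≤ q⁻¹ - 1 := sub_nonneg.2 ((one_le_inv₀ hq).2 hq1)
  -- assemble
  unfold HubUnder
  apply real_mul_le_of_mass w hq
  rw [← sum_rcWeightW_ind_univ w q]
  exact apexTwo_leaf_alg ha₁ ha₁' hb₁ hb₁' ha₂ ha₂' hb₂ hb₂' hr hs hA0 hB0 hZx hUV hUY hVY hATT hSEP hUVY hKc cE
    hA hB hAB hZ

/-! ### The hub inequality at `(x; u; y)`: hub at `u`, both legs apexes -/

/-- **The hub inequality at `(x; u; y)` for two apexes `x, y` over `(u, v)` — every `0 < q ≤ 1`, any surrounding weighted graph**: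
`φ_{w,q}(x ↔ u)·φ_{w,q}(y ↔ u) ≤ φ_{w,q}(x ↔ u ↔ y)` (Ayyer–Linusson–Ravichandran's (13)/(14) with both legs at apexes).
[cite: AyyerLinussonRavichandran2025, §7 eq. (13)–(14) (p. 22)] [cite: Grimmett2006, §3.9 (p. 63)] -/
theorem hubUnder_apex_two_hub (w : Sym2 V → unitInterval) {q : ℝ} (hq : 0 < q) (hq1 : q ≤ 1) {u v x y : V}
    (hxu : x ≠ u) (hxv : x ≠ v) (hyu : y ≠ u) (hyv : y ≠ v) (hxy : x ≠ y) (huv : u ≠ v)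
    (hwx : ∀ e : Sym2 V, x ∈ e → ((w e : unitInterval) : ℝ) ≠ 0 → u ∈ e ∨ v ∈ e)
    (hwy : ∀ e : Sym2 V, y ∈ e → ((w e : unitInterval) : ℝ) ≠ 0 → u ∈ e ∨ v ∈ e) :
    HubUnder (rcMeasureW w q ∅) x u y := by
  have hq0 : q ≠ 0 := hq.ne'
  -- auxiliary events read off `ω ∖ {ux, xv}`
  have hKa := diffApex_insens u v x (openConn u v) (Or.inl rfl)
  have hKb := diffApex_insens u v x (openConn u v) (Or.inr rfl)
  have hYUa := diffApex_insens u v x (openConn u y) (Or.inl rfl)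
  have hYUb := diffApex_insens u v x (openConn u y) (Or.inr rfl)
  have hYVa := diffApex_insens u v x (openConn v y) (Or.inl rfl)
  have hYVb := diffApex_insens u v x (openConn v y) (Or.inr rfl)
  have hapex : ∀ ω, rcWeightW w q ∅ ω ≠ 0 → ∀ e ∈ ω, x ∈ e → e = s(u, x) ∨ e = s(x, v) :=
    fun ω hω => apex_of_rcWeightW_ne_zero w q hxu hxv hwx hω
  have hadj : ∀ ω : BondConfig V, s(u, x) ∈ ω → ω ∈ (openConn u x : Set (BondConfig V)) := fun ω ha =>
    mem_openConn_of_mem hxu.symm ha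
  -- `y ↔ x` through the apex `x`
  have hyx : ∀ ω : BondConfig V, rcWeightW w q ∅ ω ≠ 0 → (ω ∈ (openConn y x : Set (BondConfig V)) ↔
      (s(u, x) ∈ ω ∧ ω ∈ {ω : BondConfig V | ω \ {s(u, x), s(x, v)} ∈ (openConn u y : Set (BondConfig V))}) ∨ (s(x, v) ∈ ω ∧ ω ∈ {ω : BondConfig V | ω \ {s(u, x), s(x, v)} ∈ (openConn v y : Set (BondConfig V))})) := fun ω hω => by
    rw [mem_openConn_iff', Set.mem_setOf_eq, Set.mem_setOf_eq, mem_openConn_iff', mem_openConn_iff']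
    rw [show (openGraph ω).Reachable y x ↔ (openGraph ω).Reachable x y from ⟨SimpleGraph.Reachable.symm, SimpleGraph.Reachable.symm⟩]
    exact reachable_apex_iff hxv hxy (hapex ω hω)
  have hux : ∀ ω : BondConfig V, rcWeightW w q ∅ ω ≠ 0 → s(u, x) ∉ ω →
      (ω ∈ (openConn u x : Set (BondConfig V)) ↔ s(x, v) ∈ ω ∧ ω ∈ {ω : BondConfig V | ω \ {s(u, x), s(x, v)} ∈ (openConn u v : Set (BondConfig V))}) := fun ω hω ha => by
    rw [mem_openConn_iff', reachable_ux_apex_iff hxu hxv (hapex ω hω), Set.mem_setOf_eq, mem_openConn_iff']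
    exact ⟨fun h => h.elim (fun h' => absurd h' ha) id, Or.inr⟩
  -- level one: the tables of the apex `x`
  have hxu' : ∀ ω : BondConfig V, ω ∈ (openConn x u : Set (BondConfig V)) ↔ ω ∈ (openConn u x : Set (BondConfig V)) :=
    fun ω => by rw [openConn_comm]
  have hyu' : ∀ ω : BondConfig V, rcWeightW w q ∅ ω ≠ 0 → (ω ∈ (openConn y u : Set (BondConfig V)) ↔
      ω ∈ {ω : BondConfig V | ω \ {s(u, x), s(x, v)} ∈ (openConn u y : Set (BondConfig V))} ∨ (s(u, x) ∈ ω ∧ s(x, v) ∈ ω ∧ ω ∈ {ω : BondConfig V | ω \ {s(u, x), s(x, v)} ∈ (openConn v y : Set (BondConfig V))})) := fun ω hω => by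
    rw [openConn_comm, mem_openConn_iff', Set.mem_setOf_eq, Set.mem_setOf_eq, mem_openConn_iff', mem_openConn_iff']
    exact reachable_uy_apex_iff hxu hxv hxy.symm (hapex ω hω)
  have hA := apex_mass_table w hq0 hxu hxv huv hwx (openConn x u) Set.univ Set.univ {ω : BondConfig V | ω \ {s(u, x), s(x, v)} ∈ (openConn u v : Set (BondConfig V))} ∅
    (fun ω _ ha _ => iff_of_true ((hxu' ω).2 (hadj ω ha)) (Set.mem_univ _))
    (fun ω _ _ ha => iff_of_true ((hxu' ω).2 (hadj ω ha)) (Set.mem_univ _))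
    (fun ω hω ha hb => by rw [hxu', hux ω hω ha]; exact ⟨fun h => h.2, fun h => ⟨hb, h⟩⟩)
    (fun ω hω ha hb => by rw [hxu', hux ω hω ha]; exact ⟨fun h => absurd h.1 hb, fun h => absurd h (Set.notMem_empty ω)⟩)
    (univ_insens _) (univ_insens _) (univ_insens _) hKb
  have hB := apex_mass_table w hq0 hxu hxv huv hwx (openConn y u) ({ω : BondConfig V | ω \ {s(u, x), s(x, v)} ∈ (openConn u y : Set (BondConfig V))} ∪ {ω : BondConfig V | ω \ {s(u, x), s(x, v)} ∈ (openConn v y : Set (BondConfig V))}) {ω : BondConfig V | ω \ {s(u, x), s(x, v)} ∈ (openConn u y : Set (BondConfig V))} {ω : BondConfig V | ω \ {s(u, x), s(x, v)} ∈ (openConn u y : Set (BondConfig V))} {ω : BondConfig V | ω \ {s(u, x), s(x, v)} ∈ (openConn u y : Set (BondConfig V))}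
    (fun ω hω ha hb => by
      rw [hyu' ω hω, Set.mem_union]
      exact ⟨fun h => h.elim Or.inl fun h' => Or.inr h'.2.2, fun h => h.elim Or.inl fun h' => Or.inr ⟨ha, hb, h'⟩⟩)
    (fun ω hω hb _ => by
      rw [hyu' ω hω]
      exact ⟨fun h => h.elim id fun h' => absurd h'.2.1 hb, Or.inl⟩)
    (fun ω hω ha _ => by
      rw [hyu' ω hω]
      exact ⟨fun h => h.elim id fun h' => absurd h'.1 ha, Or.inl⟩)
    (fun ω hω ha _ => by
      rw [hyu' ω hω]
      exact ⟨fun h => h.elim id fun h' => absurd h'.1 ha, Or.inl⟩)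
    (union_insens hYUa hYVa) (union_insens hYUb hYVb) hYUa hYUb
  have hAB := apex_mass_table w hq0 hxu hxv huv hwx ((openConn x u : Set (BondConfig V)) ∩ openConn y u)
    ({ω : BondConfig V | ω \ {s(u, x), s(x, v)} ∈ (openConn u y : Set (BondConfig V))} ∪ {ω : BondConfig V | ω \ {s(u, x), s(x, v)} ∈ (openConn v y : Set (BondConfig V))}) {ω : BondConfig V | ω \ {s(u, x), s(x, v)} ∈ (openConn u y : Set (BondConfig V))} ({ω : BondConfig V | ω \ {s(u, x), s(x, v)} ∈ (openConn u v : Set (BondConfig V))} ∩ {ω : BondConfig V | ω \ {s(u, x), s(x, v)} ∈ (openConn u y : Set (BondConfig V))}) ∅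
    (fun ω hω ha hb => by
      rw [Set.mem_inter_iff, hyu' ω hω, Set.mem_union]
      constructor
      · rintro ⟨-, h⟩; exact h.elim Or.inl fun h' => Or.inr h'.2.2
      · intro h; exact ⟨(hxu' ω).2 (hadj ω ha), h.elim Or.inl fun h' => Or.inr ⟨ha, hb, h'⟩⟩)
    (fun ω hω hb ha => by
      rw [Set.mem_inter_iff, hyu' ω hω]
      constructor
      · rintro ⟨-, h⟩; exact h.elim id fun h' => absurd h'.2.1 hb
      · intro h; exact ⟨(hxu' ω).2 (hadj ω ha), Or.inl h⟩)
    (fun ω hω ha hb => by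
      rw [Set.mem_inter_iff, hxu', hux ω hω ha, hyu' ω hω, Set.mem_inter_iff]
      constructor
      · rintro ⟨h1, h2⟩; exact ⟨h1.2, h2.elim id fun h' => absurd h'.1 ha⟩
      · rintro ⟨h1, h2⟩; exact ⟨⟨hb, h1⟩, Or.inl h2⟩)
    (fun ω hω ha hb => by
      rw [Set.mem_inter_iff, hxu', hux ω hω ha]
      exact ⟨fun h => absurd h.1.1 hb, fun h => absurd h (Set.notMem_empty ω)⟩)
    (union_insens hYUa hYVa) (union_insens hYUb hYVb) hYUa (inter_insens hKb hYUb)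
  have hZ := apex_mass_table w hq0 hxu hxv huv hwx Set.univ Set.univ Set.univ Set.univ Set.univ
    (fun _ _ _ _ => Iff.rfl) (fun _ _ _ _ => Iff.rfl) (fun _ _ _ _ => Iff.rfl) (fun _ _ _ _ => Iff.rfl)
    (univ_insens _) (univ_insens _) (univ_insens _) (univ_insens _)
  -- level two: under `w[ux, xv ↦ 0]` the auxiliary events are plain connection events, and `y` is still an apex
  have hda := apexDead_fst w hxu huv
  have hdb := apexDead_snd w u v x
  have cK : ∑ ω : BondConfig V, rcWeightW (Function.update (Function.update w s(u, x) 0) s(x, v) 0) q ∅ ω * ind {ω : BondConfig V | ω \ {s(u, x), s(x, v)} ∈ (openConn u v : Set (BondConfig V))} ω = ∑ ω : BondConfig V, rcWeightW (Function.update (Function.update w s(u, x) 0) s(x, v) 0) q ∅ ω * ind (openConn u v : Set (BondConfig V)) ω := by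
    rw [← Set.univ_inter {ω : BondConfig V | ω \ {s(u, x), s(x, v)} ∈ (openConn u v : Set (BondConfig V))}, sum_inter_preimageDiff_dead _ q hda hdb, Set.univ_inter]
  have cKc : ∑ ω : BondConfig V, rcWeightW (Function.update (Function.update w s(u, x) 0) s(x, v) 0) q ∅ ω * ind (Set.univ ∩ {ω : BondConfig V | ω \ {s(u, x), s(x, v)} ∈ (openConn u v : Set (BondConfig V))}ᶜ) ω =
      ∑ ω : BondConfig V, rcWeightW (Function.update (Function.update w s(u, x) 0) s(x, v) 0) q ∅ ω * ind (openConn u v : Set (BondConfig V))ᶜ ω := by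
    refine sum_rcWeightW_ind_congr_ae _ q fun ω hω => ?_
    rw [Set.mem_inter_iff, Set.mem_compl_iff, Set.mem_setOf_eq, diff_apex_eq_self_ae _ q hda hdb hω, Set.mem_compl_iff]
    exact ⟨fun h => h.2, fun h => ⟨Set.mem_univ _, h⟩⟩
  have cYU : ∑ ω : BondConfig V, rcWeightW (Function.update (Function.update w s(u, x) 0) s(x, v) 0) q ∅ ω * ind {ω : BondConfig V | ω \ {s(u, x), s(x, v)} ∈ (openConn u y : Set (BondConfig V))} ω = ∑ ω : BondConfig V, rcWeightW (Function.update (Function.update w s(u, x) 0) s(x, v) 0) q ∅ ω * ind (openConn u y : Set (BondConfig V)) ω := by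
    rw [← Set.univ_inter {ω : BondConfig V | ω \ {s(u, x), s(x, v)} ∈ (openConn u y : Set (BondConfig V))}, sum_inter_preimageDiff_dead _ q hda hdb, Set.univ_inter]
  have cATT : ∑ ω : BondConfig V, rcWeightW (Function.update (Function.update w s(u, x) 0) s(x, v) 0) q ∅ ω * ind ({ω : BondConfig V | ω \ {s(u, x), s(x, v)} ∈ (openConn u y : Set (BondConfig V))} ∪ {ω : BondConfig V | ω \ {s(u, x), s(x, v)} ∈ (openConn v y : Set (BondConfig V))}) ω =
      ∑ ω : BondConfig V, rcWeightW (Function.update (Function.update w s(u, x) 0) s(x, v) 0) q ∅ ω * ind ((openConn u y : Set (BondConfig V)) ∪ openConn v y) ω := by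
    refine sum_rcWeightW_ind_congr_ae _ q fun ω hω => ?_
    rw [Set.mem_union, Set.mem_union, Set.mem_setOf_eq, Set.mem_setOf_eq, diff_apex_eq_self_ae _ q hda hdb hω]
  have cSEP : ∑ ω : BondConfig V, rcWeightW (Function.update (Function.update w s(u, x) 0) s(x, v) 0) q ∅ ω * ind (({ω : BondConfig V | ω \ {s(u, x), s(x, v)} ∈ (openConn u y : Set (BondConfig V))} ∪ {ω : BondConfig V | ω \ {s(u, x), s(x, v)} ∈ (openConn v y : Set (BondConfig V))}) ∩ {ω : BondConfig V | ω \ {s(u, x), s(x, v)} ∈ (openConn u v : Set (BondConfig V))}ᶜ) ω =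
      ∑ ω : BondConfig V, rcWeightW (Function.update (Function.update w s(u, x) 0) s(x, v) 0) q ∅ ω * ind (((openConn u y : Set (BondConfig V)) ∪ openConn v y) ∩ (openConn u v)ᶜ) ω := by
    refine sum_rcWeightW_ind_congr_ae _ q fun ω hω => ?_
    simp only [Set.mem_inter_iff, Set.mem_union, Set.mem_compl_iff, Set.mem_setOf_eq, diff_apex_eq_self_ae _ q hda hdb hω]
  have cKYU : ∑ ω : BondConfig V, rcWeightW (Function.update (Function.update w s(u, x) 0) s(x, v) 0) q ∅ ω * ind ({ω : BondConfig V | ω \ {s(u, x), s(x, v)} ∈ (openConn u v : Set (BondConfig V))} ∩ {ω : BondConfig V | ω \ {s(u, x), s(x, v)} ∈ (openConn u y : Set (BondConfig V))}) ω =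
      ∑ ω : BondConfig V, rcWeightW (Function.update (Function.update w s(u, x) 0) s(x, v) 0) q ∅ ω * ind ((openConn u v : Set (BondConfig V)) ∩ openConn u y) ω := by
    refine sum_rcWeightW_ind_congr_ae _ q fun ω hω => ?_
    simp only [Set.mem_inter_iff, Set.mem_setOf_eq, diff_apex_eq_self_ae _ q hda hdb hω]
  have cE : ∑ ω : BondConfig V, rcWeightW (Function.update (Function.update w s(u, x) 0) s(x, v) 0) q ∅ ω * ind (∅ : Set (BondConfig V)) ω = 0 := sum_rcWeightW_ind_empty _ q
  rw [cKc, cK] at hA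
  rw [cATT, cSEP, cYU] at hB
  rw [cATT, cSEP, cYU, cKYU] at hAB
  rw [cKc] at hZ
  -- the level-one dictionary of the apex `y` under `w[ux, xv ↦ 0]`
  have hwy' : ∀ e : Sym2 V, y ∈ e → (((Function.update (Function.update w s(u, x) 0) s(x, v) 0) e : unitInterval) : ℝ) ≠ 0 → u ∈ e ∨ v ∈ e :=
    apex_hyp_update (apex_hyp_update hwy s(u, x) (fun _ => Or.inl (Sym2.mem_mk_left u x)) 0) s(x, v)
      (fun _ => Or.inr (Sym2.mem_mk_right x v)) 0
  have hZx := apexForm_univ (Function.update (Function.update w s(u, x) 0) s(x, v) 0) hq0 hyu hyv huv hwy'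
  have hUV := apexForm_uv (Function.update (Function.update w s(u, x) 0) s(x, v) 0) hq0 hyu hyv huv hwy'
  have hUY := apexForm_uy (Function.update (Function.update w s(u, x) 0) s(x, v) 0) hq0 hyu hyv huv hwy'
  have hATT := apexForm_att (Function.update (Function.update w s(u, x) 0) s(x, v) 0) hq0 hyu hyv huv hwy'
  have hSEP := apexForm_att_sep (Function.update (Function.update w s(u, x) 0) s(x, v) 0) hq0 hyu hyv huv hwy'
  have hUVY := apexForm_uv_uy (Function.update (Function.update w s(u, x) 0) s(x, v) 0) hq0 hyu hyv huv hwy'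
  have hsplit := sum_rcWeightW_ind_univ_eq_add (Function.update (Function.update (Function.update (Function.update w s(u, x) 0) s(x, v) 0) s(u, y) 0) s(y, v) 0) q
    {ω : BondConfig V | ω \ {s(u, y), s(y, v)} ∈ (openConn u v : Set (BondConfig V))}
  rw [hsplit] at hZx hUV hUY hATT hUVY
  have hKc : ∑ ω : BondConfig V, rcWeightW (Function.update (Function.update w s(u, x) 0) s(x, v) 0) q ∅ ω * ind (openConn u v : Set (BondConfig V))ᶜ ω =
      ∑ ω : BondConfig V, rcWeightW (Function.update (Function.update w s(u, x) 0) s(x, v) 0) q ∅ ω * ind (Set.univ : Set (BondConfig V)) ω - ∑ ω : BondConfig V, rcWeightW (Function.update (Function.update w s(u, x) 0) s(x, v) 0) q ∅ ω * ind (openConn u v : Set (BondConfig V)) ω := by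
    rw [sum_rcWeightW_ind_compl, sum_rcWeightW_ind_univ]
  -- signs
  have hA0 := sum_rcWeightW_ind_nonneg (Function.update (Function.update (Function.update (Function.update w s(u, x) 0) s(x, v) 0) s(u, y) 0) s(y, v) 0) hq.le
    {ω : BondConfig V | ω \ {s(u, y), s(y, v)} ∈ (openConn u v : Set (BondConfig V))}
  have hB0 := sum_rcWeightW_ind_nonneg (Function.update (Function.update (Function.update (Function.update w s(u, x) 0) s(x, v) 0) s(u, y) 0) s(y, v) 0) hq.le
    {ω : BondConfig V | ω \ {s(u, y), s(y, v)} ∈ (openConn u v : Set (BondConfig V))}ᶜ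
  have ha₁ : 0 ≤ ((w s(u, x) : unitInterval) : ℝ) := (w s(u, x)).2.1
  have ha₁' : 0 ≤ 1 - ((w s(u, x) : unitInterval) : ℝ) := sub_nonneg.2 (w s(u, x)).2.2
  have hb₁ : 0 ≤ ((w s(x, v) : unitInterval) : ℝ) := (w s(x, v)).2.1
  have hb₁' : 0 ≤ 1 - ((w s(x, v) : unitInterval) : ℝ) := sub_nonneg.2 (w s(x, v)).2.2
  have ha₂ : 0 ≤ (((Function.update (Function.update w s(u, x) 0) s(x, v) 0) s(u, y) : unitInterval) : ℝ) := ((Function.update (Function.update w s(u, x) 0) s(x, v) 0) s(u, y)).2.1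
  have ha₂' : 0 ≤ 1 - (((Function.update (Function.update w s(u, x) 0) s(x, v) 0) s(u, y) : unitInterval) : ℝ) := sub_nonneg.2 ((Function.update (Function.update w s(u, x) 0) s(x, v) 0) s(u, y)).2.2
  have hb₂ : 0 ≤ (((Function.update (Function.update w s(u, x) 0) s(x, v) 0) s(y, v) : unitInterval) : ℝ) := ((Function.update (Function.update w s(u, x) 0) s(x, v) 0) s(y, v)).2.1
  have hb₂' : 0 ≤ 1 - (((Function.update (Function.update w s(u, x) 0) s(x, v) 0) s(y, v) : unitInterval) : ℝ) := sub_nonneg.2 ((Function.update (Function.update w s(u, x) 0) s(x, v) 0) s(y, v)).2.2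
  have hr : q⁻¹ = 1 + (q⁻¹ - 1) := by ring
  have hs : 0 ≤ q⁻¹ - 1 := sub_nonneg.2 ((one_le_inv₀ hq).2 hq1)
  -- assemble
  unfold HubUnder
  apply real_mul_le_of_mass w hq
  rw [← sum_rcWeightW_ind_univ w q]
  exact apexTwo_hub_alg ha₁ ha₁' hb₁ hb₁' ha₂ ha₂' hb₂ hb₂' hr hs hA0 hB0 hZx hUV hUY hATT hSEP hUVY hKc cE
    hA hB hAB hZ

end FK

end Summit.CriticalPhenomena.PercolationContinuityZ3.Theorems

end
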